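import Summits.BirchSwinnertonDyer.BirchSwinnertonDyer.Theses.UniversalToricDescent
import Summits.BirchSwinnertonDyer.BirchSwinnertonDyer.Theorems.UniversalToricDescentToricTransportModThreeStubRatSqueeze
import Summits.BirchSwinnertonDyer.BirchSwinnertonDyer.Theorems.UniversalToricDescentRationalSplitIMCInclusionAtThreeOfWall
import Summits.BirchSwinnertonDyer.BirchSwinnertonDyer.Theorems.UniversalToricDescentAcDualMuZeroCriterion
import Summits.BirchSwinnertonDyer.BirchSwinnertonDyer.Theorems.AlignedTransportAtTwoMainConjectureOfRankZeroBSDAtTwoSelmerLayerMuDoorOneLayer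
import Summits.BirchSwinnertonDyer.Rank1Residual.X11b.AnticyclotomicDualPair
import Summits.BirchSwinnertonDyer.Rank1Residual.X11b.AnticyclotomicModuleFinite
import Literature.NumberTheory.IwasawaTheory.IwasawaModuleLambdaLayersOfRankJump
import HarnessLib

/-!
# Crux `AdditiveSplitIMCInclusionAtThree` (stmt-BirchSwinnertonDyer-20395) — node `one_layer_density_door`
# (crux-ideate cover g19; UNREGISTERED node, `sorry` only in `stub_*`; concludes the crux BY NAME)

THE `μ`-HALF AS A DENSITY STATEMENT AT ONE FINITE LAYER.  Every earlier node types the surplus of the wall over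
RATWALL (24207) as a BOUNDEDNESS / FINITENESS statement along the whole anticyclotomic tower (`μ(X_(∅,0)) = 0`:
g7 `wall_iff_ratwall_and_muDominance`; `Sel_(∅,0)(K_∞,E[3])` finite: g8/g10/g14/g17; bounded teeth: g3/g7; twin:
24737) and every SOURCE for such a tower statement died or is open.  This node uses the one lever none of the 26 filed
ideas uses: **the `𝔽₃⟦T⟧`-rank of `X/3X` is an INTEGER**, so `μ` is decided by a DENSITY inequality at ONE finite
layer (Washington §13.3 Prop. 13.22–13.23 / Fukuda 1994 / tree `IwasawaModuleRankJump`, landed as the p = 2 door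
`AlignedTransportAtTwo…SelmerLayerMuDoorOneLayer`):

* **ONELAYER** (`OneLayerSubmaximalGrowthAtThree`): at every wall frame there is ONE `n` with
  `#X/(ω_n, 3)X < 3^{3ⁿ}` for `X = X_(∅,0)(E/K_∞)` (module currency).  By the landed one-layer lemma this forces
  `X` `Λ`-torsion AND `μ(X) = 0` (`isTorsion_and_muZero_of_oneLayer`, PROVED), and conversely `X` torsion with
  `μ(X) = 0` gives ONELAYER back (`oneLayer_of_isTorsion_of_muZero`, PROVED) — so ONELAYER ⟺ (torsion ∧ `μ = 0`):
  tag UNDECIDED · EQUIV to the algebraic `μ`-half ⟹ this node GIVES IT CHILDREN (D1, D2 below).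
* **KERNEL** (`wall_of_ratwall_of_oneLayer`, PROVED, no UNIT / Hsieh hypothesis needed): RATWALL gives
  `g ∣ 3ᵏ·L` for the generator `g` of `Ch_Λ(X)·R₀⟦T⟧`; ONELAYER gives `μ(X) = 0`, i.e. a norm-one coefficient of `g`
  (tree `exists_map_charIdeal_eq_span_of_muInvariant_eq_zero`), i.e. `3 ∤ g`; Gauss (`dvd_of_dvd_prime_pow_mul`,
  landed in `RatwallThinComb`) strips the `3ᵏ`: `g ∣ L`, which IS the wall.
* **D1 = COUNT** (`LayerResidualCountAtThree`, ATTACKABLE, pure Pontryagin algebra over the landed dual pair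
  `XAc.isDualPair`): `#X/(ω_n,3)X = #{s ∈ Sel_(∅,0)(K_∞,E[3^∞]) : 3s = 0, γ^{3ⁿ}s = s}` — the two one-generator
  cases are landed (`IsDualPair.natCard_layerCoinvariants` for `ω_n`, `finite_quotient_pSmul_of_finite_pTorsion` for
  `3`); the two-generator count is their common refinement.
* **D2 = SELMER DOOR** (`OneLayerResidualSelmerBoundAtThree`, UNDECIDED; INSTRUMENTABLE per row, IDEA-NEEDED
  class-wide): ONE `n` with `dim_{𝔽₃} Sel_(∅,0)(K_∞,E[3^∞])[3]^{Γₙ} < 3ⁿ = [Kₙ : K]`.  Density, not boundedness: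
  the budget tolerates `(1 − ε)·3ⁿ` classes, in particular the `(1/3)·3ⁿ` trace-zero loss that killed the exact
  single-layer Kolyvagin count (g3 dead end "cokernel `3^{n-1}`").
* COMPOSITION `AdditiveSplitIMCInclusionAtThree_of : RATWALL → COUNT → SELMERDOOR → WALL` kernel-checked.

Binders of the algebraic pieces = the wall's arithmetic binders verbatim with the analytic ones (`Dt, ι', ΩK, Ωp, L`)
dropped (the pieces do not mention `L`).  No unsafe options; `sorry` only in the three `stub_*`.
-/

set_option linter.dupNamespace false
set_option autoImplicit false

noncomputable section

open scoped Classical NumberField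
open NumberField IsDedekindDomain Field WeierstrassCurve
open Literature.NumberTheory.EllipticCurves Literature.NumberTheory.EllipticCurves.IwasawaAlgebra
open Literature.NumberTheory.EllipticCurves.ZpExtension
open Summit.BirchSwinnertonDyer.Rank1Residual.X11b Summit.BirchSwinnertonDyer.Rank1Residual.X11b.AcSelmer
open Summit.BirchSwinnertonDyer.BirchSwinnertonDyer.Theses.UniversalToricDescent
open Summit.BirchSwinnertonDyer.BirchSwinnertonDyer.Cruxes.ToricTransportModThree.RatwallThinComb
open Summit.BirchSwinnertonDyer.BirchSwinnertonDyer.Theorems.UniversalToricDescentAcDualMuZero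
  (exists_map_charIdeal_eq_span_of_muInvariant_eq_zero)
open Summit.BirchSwinnertonDyer.BirchSwinnertonDyer.Theorems.AlignedTransportAtTwoSelmerLayerMuDoorOneLayer
  (mu_eq_zero_of_card_layerQuotient_lt_pow)
open Literature.NumberTheory.IwasawaTheory.IwasawaModuleRankJump
  (omega_smul_top_eq exists_forall_smul_top_eq_of_finite_quotient_augIdealP
    finite_quotient_augIdealP_of_muInvariant_eq_zero)

namespace Summit.BirchSwinnertonDyer.BirchSwinnertonDyer.Cruxes.AdditiveSplitIMCInclusionAtThree.OneLayerDensityDoor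

/-! ## §1 Generic algebra: the one-layer door and its converse (any prime `p`, any finitely generated `Λ`-module) -/

section Algebra

variable {p : ℕ} [hp : Fact p.Prime] {M : Type} [AddCommGroup M] [Module (IwasawaAlgebra p) M]
  [Module.Finite (IwasawaAlgebra p) M]

/-- **One layer decides torsion and `μ`** (landed one-layer form of the rank-jump criterion, re-exported):
`#M/(ω_n, p)M < p^{pⁿ}` for ONE `n` ⟹ `M` is `Λ`-torsion and `μ(M) = 0`.
[cite: Washington1997, §13.3 Prop. 13.22–13.23] [cite: Fukuda1994, Thm. 1] -/
theorem isTorsion_and_muZero_of_card_lt (n : ℕ)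
    (hlt : Nat.card (M ⧸ (Ideal.span {((1 + PowerSeries.X) ^ p ^ n - 1 : IwasawaAlgebra p)} ⊔ augIdealP p) •
      (⊤ : Submodule (IwasawaAlgebra p) M)) < p ^ (p ^ n)) :
    Module.IsTorsion (IwasawaAlgebra p) M ∧ muInvariant p M = 0 :=
  ⟨(mu_eq_zero_of_card_layerQuotient_lt_pow n hlt).1, (mu_eq_zero_of_card_layerQuotient_lt_pow n hlt).2.1⟩

/-- **Converse (the door is complete at one layer)**: a finitely generated torsion `Λ`-module with `μ = 0` has
`#M/(ω_n, p)M < p^{pⁿ}` for some `n` (`M/pM` is finite, `(ω_n, p)M = (T^{pⁿ}, p)M = pM` for `pⁿ` large, and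
`#M/pM < p^{pⁿ}` for `n` large). [cite: Washington1997, §13.3 Prop. 13.23] -/
theorem exists_card_lt_of_isTorsion_of_muZero (hM : Module.IsTorsion (IwasawaAlgebra p) M)
    (hμ : muInvariant p M = 0) :
    ∃ n : ℕ, Nat.card (M ⧸ (Ideal.span {((1 + PowerSeries.X) ^ p ^ n - 1 : IwasawaAlgebra p)} ⊔ augIdealP p) •
      (⊤ : Submodule (IwasawaAlgebra p) M)) < p ^ (p ^ n) := by
  have hfin := finite_quotient_augIdealP_of_muInvariant_eq_zero hM hμ
  haveI := hfin
  obtain ⟨n₀, hn₀⟩ := exists_forall_smul_top_eq_of_finite_quotient_augIdealP (M := M) hfin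
  set c : ℕ := Nat.card (M ⧸ augIdealP p • (⊤ : Submodule (IwasawaAlgebra p) M)) with hc
  have h1 : n₀ + c < p ^ (n₀ + c) := Nat.lt_pow_self hp.out.one_lt
  have h2 : p ^ (n₀ + c) ≤ p ^ (p ^ (n₀ + c)) := Nat.pow_le_pow_right hp.out.pos h1.le
  refine ⟨n₀ + c, ?_⟩
  rw [omega_smul_top_eq, hn₀ (p ^ (n₀ + c)) ((Nat.le_add_right n₀ c).trans h1.le)]
  calc c ≤ n₀ + c := Nat.le_add_left c n₀
    _ < p ^ (n₀ + c) := h1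
    _ ≤ p ^ (p ^ (n₀ + c)) := h2

end Algebra

/-! ## §2 The pieces (Props; binders = the wall's arithmetic binders, analytic binders dropped) -/

section Pieces

variable {K : Type} [Field K] [NumberField K]

/-- The layer-`n` residual Selmer set `Sel_𝔭^Σ(K_∞, E[p^∞])[p]^{γ^{pⁿ} = 1}` = the `p`-torsion classes of the
anticyclotomic Greenberg Selmer group fixed by `Γₙ = Γ^{pⁿ}` (Pontryagin dual of `X/(ω_n, p)X`).
[cite: GreenbergLNM1716, §1 p. 60 (after Conj. 1.3)] [cite: Castella2018, §2.1 (arXiv:1704.06608 p. 5)] -/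
def layerResidualSet (W : WeierstrassCurve K) (p : ℕ) [Fact p.Prime] (κ : ZpExtension K p)
    (𝔭 : HeightOneSpectrum (𝓞 K)) (S : Set (HeightOneSpectrum (𝓞 K))) (γ : absoluteGaloisGroup K) (n : ℕ) :
    Set (selmerAc W p κ 𝔭 S) :=
  {s | p • s = 0 ∧ ((conjSelmerAc W p κ 𝔭 S γ) ^ (p ^ n)) s = s}

end Pieces

/-- PIECE ONELAYER (module currency; tag UNDECIDED · EQUIV to «`X_(∅,0)(E/K_∞)` torsion ∧ `μ = 0`» by
`isTorsion_and_muZero_of_card_lt` / `exists_card_lt_of_isTorsion_of_muZero`): at every wall frame there is ONE layer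
`n` with `#X/(ω_n, 3)X < 3^{3ⁿ}`, `X = X_(∅,0)(E/K_∞) = XAc (E/K) 3 κ 𝔭' ∅ γ`.
[cite: Washington1997, §13.3 Prop. 13.22–13.23] [cite: Fukuda1994, Thm. 1] -/
def OneLayerSubmaximalGrowthAtThree : Prop :=
  ∀ (W : WeierstrassCurve ℚ) [W.IsElliptic] [W.IsGloballyMinimal] (N : ℕ) [NeZero N] (K : Type) [Field K]
    [NumberField K],
    Summit.BirchSwinnertonDyer.Rank1Residual.Additive.ClassO6 W 3 → W.HasSurjectiveModNGaloisRep 3 →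
    W.analyticRank = 1 → W.conductorNorm ℤ = N → IsImaginaryQuadratic K → SatisfiesHeegnerHypothesis N K →
    ∀ (κ : ZpExtension K 3), κ.IsAnticyclotomic →
    ∀ (γ : Field.absoluteGaloisGroup K) [Fact (κ.IsTopGenerator γ)]
      (𝔭 : IsDedekindDomain.HeightOneSpectrum (NumberField.RingOfIntegers K)),
      ((3 : ℕ) : NumberField.RingOfIntegers K) ∈ 𝔭.asIdeal →
      𝔭.asIdeal.ramificationIdx (NumberField.RingOfIntegers ℚ) = 1 →
      𝔭.asIdeal.inertiaDeg (NumberField.RingOfIntegers ℚ) = 1 →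
      ∀ (𝔭' : IsDedekindDomain.HeightOneSpectrum (NumberField.RingOfIntegers K)),
        ((3 : ℕ) : NumberField.RingOfIntegers K) ∈ 𝔭'.asIdeal → 𝔭' ≠ 𝔭 →
        ∃ n : ℕ,
          Nat.card (XAc (W.baseChange K) 3 κ 𝔭' ∅ γ ⧸
              (Ideal.span {((1 + PowerSeries.X) ^ 3 ^ n - 1 : IwasawaAlgebra 3)} ⊔ augIdealP 3) •
                (⊤ : Submodule (IwasawaAlgebra 3) (XAc (W.baseChange K) 3 κ 𝔭' ∅ γ))) <
            3 ^ (3 ^ n)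

/-- PIECE D1 = COUNT (tag ATTACKABLE: pure Pontryagin algebra over the landed dual pair `XAc.isDualPair`; the
one-generator cases `ω_n` (`IsDualPair.natCard_layerCoinvariants`) and `p` (`finite_quotient_pSmul_of_finite_pTorsion`)
are landed): `#X/(ω_n, 3)X = #Sel_(∅,0)(K_∞, E[3^∞])[3]^{γ^{3ⁿ}}` whenever the latter is finite, for every curve over a
number field and every frame. [cite: GreenbergLNM1716, §1 p. 60 (after Conj. 1.3)] [cite: Washington1997, §13.3] -/
def LayerResidualCountAtThree : Prop :=
  ∀ (K : Type) [Field K] [NumberField K] (W : WeierstrassCurve K) [W.IsElliptic] (κ : ZpExtension K 3)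
    (𝔭 : IsDedekindDomain.HeightOneSpectrum (NumberField.RingOfIntegers K)) (γ : Field.absoluteGaloisGroup K)
    [Fact (κ.IsTopGenerator γ)] (n : ℕ),
    (layerResidualSet W 3 κ 𝔭 ∅ γ n).Finite →
      Nat.card (XAc W 3 κ 𝔭 ∅ γ ⧸
          (Ideal.span {((1 + PowerSeries.X) ^ 3 ^ n - 1 : IwasawaAlgebra 3)} ⊔ augIdealP 3) •
            (⊤ : Submodule (IwasawaAlgebra 3) (XAc W 3 κ 𝔭 ∅ γ))) =
        Nat.card (layerResidualSet W 3 κ 𝔭 ∅ γ n)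

/-- PIECE D2 = SELMER DOOR (tag UNDECIDED; INSTRUMENTABLE per row (`n = 0, 1`: a 3-descent over `K`, resp. the
sextic `K₁`), IDEA-NEEDED class-wide): at every wall frame there is ONE layer `n` at which the residual Selmer set is
finite and has fewer than `3^{3ⁿ}` elements, i.e. `dim_{𝔽₃} Sel_(∅,0)(K_∞,E[3^∞])[3]^{Γₙ} < 3ⁿ = [Kₙ : K]` —
SUBMAXIMAL DENSITY at one layer, not boundedness. [cite: Washington1997, §13.3 Prop. 13.22–13.23]
[cite: Fukuda1994, Thm. 1] [cite: BertoliniDarmon2005, Prop. 3.3] -/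
def OneLayerResidualSelmerBoundAtThree : Prop :=
  ∀ (W : WeierstrassCurve ℚ) [W.IsElliptic] [W.IsGloballyMinimal] (N : ℕ) [NeZero N] (K : Type) [Field K]
    [NumberField K],
    Summit.BirchSwinnertonDyer.Rank1Residual.Additive.ClassO6 W 3 → W.HasSurjectiveModNGaloisRep 3 →
    W.analyticRank = 1 → W.conductorNorm ℤ = N → IsImaginaryQuadratic K → SatisfiesHeegnerHypothesis N K →
    ∀ (κ : ZpExtension K 3), κ.IsAnticyclotomic →
    ∀ (γ : Field.absoluteGaloisGroup K) [Fact (κ.IsTopGenerator γ)]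
      (𝔭 : IsDedekindDomain.HeightOneSpectrum (NumberField.RingOfIntegers K)),
      ((3 : ℕ) : NumberField.RingOfIntegers K) ∈ 𝔭.asIdeal →
      𝔭.asIdeal.ramificationIdx (NumberField.RingOfIntegers ℚ) = 1 →
      𝔭.asIdeal.inertiaDeg (NumberField.RingOfIntegers ℚ) = 1 →
      ∀ (𝔭' : IsDedekindDomain.HeightOneSpectrum (NumberField.RingOfIntegers K)),
        ((3 : ℕ) : NumberField.RingOfIntegers K) ∈ 𝔭'.asIdeal → 𝔭' ≠ 𝔭 →
        ∃ n : ℕ, (layerResidualSet (W.baseChange K) 3 κ 𝔭' ∅ γ n).Finite ∧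
          Nat.card (layerResidualSet (W.baseChange K) 3 κ 𝔭' ∅ γ n) < 3 ^ (3 ^ n)

/-! ## §3 KERNEL: RATWALL ∧ ONELAYER ⟹ WALL (proved; concludes the crux BY NAME; no UNIT hypothesis) -/

/-- **ONELAYER ⟹ `X_(∅,0)(E/K_∞)` torsion with `μ = 0` at every wall frame** (proved).
[cite: Washington1997, §13.3 Prop. 13.22–13.23] [cite: Fukuda1994, Thm. 1] -/
theorem isTorsion_and_muZero_of_oneLayer (h : OneLayerSubmaximalGrowthAtThree)
    (W : WeierstrassCurve ℚ) [W.IsElliptic] [W.IsGloballyMinimal] (N : ℕ) [NeZero N] (K : Type) [Field K]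
    [NumberField K]
    (hO6 : Summit.BirchSwinnertonDyer.Rank1Residual.Additive.ClassO6 W 3) (hsurj : W.HasSurjectiveModNGaloisRep 3)
    (hr1 : W.analyticRank = 1) (hN : W.conductorNorm ℤ = N) (hK : IsImaginaryQuadratic K)
    (hH : SatisfiesHeegnerHypothesis N K) (κ : ZpExtension K 3) (hκ : κ.IsAnticyclotomic)
    (γ : Field.absoluteGaloisGroup K) [Fact (κ.IsTopGenerator γ)]
    (𝔭 : IsDedekindDomain.HeightOneSpectrum (NumberField.RingOfIntegers K))
    (h3 : ((3 : ℕ) : NumberField.RingOfIntegers K) ∈ 𝔭.asIdeal)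
    (he : 𝔭.asIdeal.ramificationIdx (NumberField.RingOfIntegers ℚ) = 1)
    (hf : 𝔭.asIdeal.inertiaDeg (NumberField.RingOfIntegers ℚ) = 1)
    (𝔭' : IsDedekindDomain.HeightOneSpectrum (NumberField.RingOfIntegers K))
    (h3' : ((3 : ℕ) : NumberField.RingOfIntegers K) ∈ 𝔭'.asIdeal) (hne : 𝔭' ≠ 𝔭) :
    Module.IsTorsion (IwasawaAlgebra 3) (XAc (W.baseChange K) 3 κ 𝔭' ∅ γ) ∧
      muInvariant 3 (XAc (W.baseChange K) 3 κ 𝔭' ∅ γ) = 0 := by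
  haveI : Module.Finite (IwasawaAlgebra 3) (XAc (W.baseChange K) 3 κ 𝔭' ∅ γ) :=
    XAc.module_finite κ 𝔭' ∅ γ Set.finite_empty (W := W.baseChange K)
  obtain ⟨n, hn⟩ := h W N K hO6 hsurj hr1 hN hK hH κ hκ γ 𝔭 h3 he hf 𝔭' h3' hne
  exact isTorsion_and_muZero_of_card_lt n hn

/-- **The wall from RATWALL + ONELAYER** (kernel, proved): `g ∣ 3ᵏ·L` (RATWALL) and `3 ∤ g` (`μ(X) = 0` from ONELAYER
read as a norm-one coefficient of `g`, tree `exists_map_charIdeal_eq_span_of_muInvariant_eq_zero`) give `g ∣ L` by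
Gauss's lemma in `R₀⟦T⟧` (`dvd_of_dvd_prime_pow_mul`). [cite: Washington1997, §13.2–13.3]
[cite: GreenbergVatsal2000, p. 2, (1)–(2)] -/
theorem wall_of_ratwall_of_oneLayer :
    RationalSplitIMCInclusionAtThree → OneLayerSubmaximalGrowthAtThree → AdditiveSplitIMCInclusionAtThree := by
  intro hR hO W _ _ N _ K _ _ Dt hO6 hsurj hr1 hN hK hH κ hκ γ _ 𝔭 h3 he hf 𝔭' h3' hne ι' hι ΩK Ωp L hΩK hΩp hL
  obtain ⟨k, hk⟩ := hR W N K Dt hO6 hsurj hr1 hN hK hH κ hκ γ 𝔭 h3 he hf 𝔭' h3' hne ι' hι ΩK Ωp L hΩK hΩp hL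
  haveI : Module.Finite (IwasawaAlgebra 3) (XAc (W.baseChange K) 3 κ 𝔭' ∅ γ) :=
    XAc.module_finite κ 𝔭' ∅ γ Set.finite_empty (W := W.baseChange K)
  obtain ⟨hT, hμ⟩ :=
    isTorsion_and_muZero_of_oneLayer hO W N K hO6 hsurj hr1 hN hK hH κ hκ γ 𝔭 h3 he hf 𝔭' h3' hne
  obtain ⟨g, hg, i, hi⟩ :=
    exists_map_charIdeal_eq_span_of_muInvariant_eq_zero (XAc (W.baseChange K) 3 κ 𝔭' ∅ γ) hT hμ
  have hg' : (XAc.charIdeal (W.baseChange K) 3 κ 𝔭' ∅ γ).map (PowerSeries.map (Halves.toUnr 3)) =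
      Ideal.span {g} := hg
  rw [hg'] at hk ⊢
  have hdvd : g ∣ ((3 : ℕ) : UnrSeries 3) ^ k * L := Ideal.mem_span_singleton.mp hk
  rw [← map_natCast (PowerSeries.C (R := unrIntegers 3))] at hdvd
  exact Ideal.span_singleton_le_span_singleton.mpr
    (dvd_of_dvd_prime_pow_mul prime_C_three (not_C_three_dvd_of_norm_coeff_eq_one hi) k hdvd)

/-- Converse bookkeeping (landed): the wall gives RATWALL back. [cite: Washington1997, §13.2] -/
theorem ratwall_of_wall : AdditiveSplitIMCInclusionAtThree → RationalSplitIMCInclusionAtThree :=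
  Summit.BirchSwinnertonDyer.BirchSwinnertonDyer.Theorems.UniversalToricDescentRationalSplitIMCInclusionAtThreeOfWall.rationalSplitIMCInclusionAtThree_of_wall

/-! ## §4 LEVEL 2: the Selmer door feeds ONELAYER through the count (composition kernel-checked) -/

/-- **COUNT ∧ SELMERDOOR ⟹ ONELAYER** (proved: rewrite the module-currency cardinality as the Selmer-currency one).
[cite: GreenbergLNM1716, §1 p. 60 (after Conj. 1.3)] [cite: Washington1997, §13.3] -/
theorem oneLayer_of_count_of_selmerDoor :
    LayerResidualCountAtThree → OneLayerResidualSelmerBoundAtThree → OneLayerSubmaximalGrowthAtThree := by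
  intro hC hD W _ _ N _ K _ _ hO6 hsurj hr1 hN hK hH κ hκ γ _ 𝔭 h3 he hf 𝔭' h3' hne
  obtain ⟨n, hfin, hlt⟩ := hD W N K hO6 hsurj hr1 hN hK hH κ hκ γ 𝔭 h3 he hf 𝔭' h3' hne
  refine ⟨n, ?_⟩
  rw [hC K (W.baseChange K) κ 𝔭' γ n hfin]
  exact hlt

/-! ## §5 Registered stubs and the composition concluding the crux BY NAME -/

/-- STUB (= sibling crux 24207, LEAD thin_comb; WEAKER than the wall: `ratwall_of_wall`). -/
theorem stub_ratwall : RationalSplitIMCInclusionAtThree := by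
  sorry

/-- STUB D1 (ATTACKABLE, pure Pontryagin algebra; M-sized). -/
theorem stub_layerResidualCount : LayerResidualCountAtThree := by
  sorry

/-- STUB D2 (UNDECIDED; the arithmetic content of the `μ`-half in one-layer density form). -/
theorem stub_oneLayerResidualSelmerBound : OneLayerResidualSelmerBoundAtThree := by
  sorry

/-- **COMPOSITION** (kernel-checked, no `sorry`): RATWALL → COUNT → SELMERDOOR → the crux, BY NAME. -/
theorem AdditiveSplitIMCInclusionAtThree_of :
    RationalSplitIMCInclusionAtThree → LayerResidualCountAtThree → OneLayerResidualSelmerBoundAtThree →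
      AdditiveSplitIMCInclusionAtThree :=
  fun hR hC hD ↦ wall_of_ratwall_of_oneLayer hR (oneLayer_of_count_of_selmerDoor hC hD)

/-- The crux from the three registered stubs. -/
theorem AdditiveSplitIMCInclusionAtThree_holds_of_stubs : AdditiveSplitIMCInclusionAtThree :=
  AdditiveSplitIMCInclusionAtThree_of stub_ratwall stub_layerResidualCount stub_oneLayerResidualSelmerBound

end Summit.BirchSwinnertonDyer.BirchSwinnertonDyer.Cruxes.AdditiveSplitIMCInclusionAtThree.OneLayerDensityDoor

end
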